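import Summits.BirchSwinnertonDyer.Rank1Residual.X11a.PrintDischargeMuAn
import Literature.NumberTheory.EllipticCurves.Rank1Residual.X11aPrintCertificates.ClaimMu
import Literature.NumberTheory.EllipticCurves.KrausOesterle1992.TorsionCongruenceCriterionHasseWeil
import HarnessLib

/-!
# Class X11a — the PRINT route's discharge interface, part 7: record-level consumers of the μ-claim
# of the certificate schema (crux `X11aNonSurjEulerHalf` per pair) and the Kraus–Oesterlé door

Cell `bsd-print-x11a` (D-0131 print tier), seat ty2 (the DISCHARGE INTERFACE). THEOREMS ONLY (no
definition, no named fact, no `sorry`). Sequel of part 6 (`PrintDischargeMuAn.lean`: the analytic-μ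
door `ClassX11a.missingUpperBoundAt_of_muAnZeroAt_of_not_surj` on the non-surjective sub-leaf and the
exceptional-zero door at a split pair).

* §2 record-level consumers for ty3's certificate schema
  (`Literature/…/X11aPrintCertificates/{Schema,Claim,ClaimMu}.lean`): `X11a.muAnZeroAt_of_record_muClaim`
  (a record's `MuClaim` with a non-empty μ-witness column IS `X11a.MuAnZeroAt r.curve r.p` — the claim was
  written verbatim in that body; Literature cannot import Summits, so the identification is made here),
  `X11a.classX11a_of_record_claim`, **`X11a.missingUpperBoundAt_of_record_muClaim`** (a record `r` with
  `r.check = true`, `r.Claim`, `r.mu ≠ []`, `r.MuClaim` and the displayed image bit `¬ Surj r.curve r.p`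
  gives `Typed.MissingUpperBoundAt r.curve r.p` modulo the ten facts + Greenberg–Stevens at the pair) and
  `X11a.bsdp_of_record_muClaim` (`BSDp r.curve r.p` when moreover `r.ordpShaAn = 0`), and the NON-SPLIT
  variants `…_of_nonsplit` without the Greenberg–Stevens binder (part 6 §1c). The image bit is NOT
  part of `r.Claim` for a non-surjective record (images `3Ns/3Nn/5Ns/5S4/7Ns` are certified by two engines,
  not by the kernel) and is therefore a separate displayed binder, as in p3's `X11a/ChaRecords*.lean`.
* §3 the Kraus–Oesterlé 1992 Prop. 4 door `ClassX11a.torsionIso_of_krausOesterle` (print-faithful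
  Hasse–Weil twin `KrausOesterle1992.prop4_torsionIso_of_congruences_hasseWeil`, PUB; `Irr` from the
  class): a FINITE congruence list below `μ(M)/6` gives the `Γ_ℚ`-equivariant `A[p] ≃+ W[p]` that the
  visibility closing form (`θ`/`hθ`, part 1 §6) and the μ-transport forms (`hiso`, part 3) take as a
  binder; `X11a.bsdp_of_krausOesterle_of_rank_two` is part 1's visibility form with `θ` so supplied.

HONEST FRAMING: per pair (E1 currency), never the leaf; nothing here proves a μ-claim or a congruence
list; the leaf `ClassX11a` stays open; BSD is not proved by any of this. beyond-print theorem: no.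

References: [Kato2004Asterisque] Thm. 12.4 (p. 221), §17.13 (pp. 279–280); [Wuthrich2014] Cor. 18
(p. 398), Prop. 21 (p. 400); [SteinWuthrich2013] Thm. 6.1 (p. 20); [MazurTateTeitelbaum1986] §I.10,
§I.13; [Miller2011LMS] Def. 1.1; [KrausOesterle1992] Prop. 4 (pp. 263–264), p. 265 L13–15;
[CremonaMazur2000] §3; cell files `pub/bsd-print-x11a/TY2-DISCHARGE-INTERFACE.md` §J,
`TY3-CERTIFICATE-RECORDS.md`.
-/

set_option autoImplicit false

noncomputable section

open scoped Classical MatrixGroups ModularForm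

open CongruenceSubgroup WeierstrassCurve Literature.NumberTheory.EllipticCurves
  Literature.NumberTheory.EllipticCurves.ModularForms
  Literature.NumberTheory.EllipticCurves.Rank1Residual
  Literature.NumberTheory.EllipticCurves.Rank1Residual.Typed
  Literature.NumberTheory.EllipticCurves.Rank1Residual.X11aPrintCertificates
  Literature.NumberTheory.EllipticCurves.Wuthrich2014
  Literature.NumberTheory.EllipticCurves.SteinWuthrich2013
  Literature.NumberTheory.EllipticCurves.Greenberg1999
  Literature.NumberTheory.EllipticCurves.Kato2004
  Literature.NumberTheory.EllipticCurves.KrausOesterle1992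

namespace Summit.BirchSwinnertonDyer.Rank1Residual.X11a

variable {W : WeierstrassCurve ℚ} [W.IsElliptic] [W.IsGloballyMinimal] {p : ℕ} [Fact p.Prime]

/-! ### §2 Record-level consumers: the certificate schema's μ-claim (`ClaimMu.lean`) feeds the door -/

section Records

variable (r : Record) [Fact r.p.Prime] [r.curve.IsElliptic] [r.curve.IsGloballyMinimal]

/-- **A record's μ-claim IS the tree's `X11a.MuAnZeroAt` for its curve and prime** when the μ-witness
column is non-empty — `Record.MuClaim` was written VERBATIM in the body of `X11a.MuAnZeroAt`
(`ClaimMu.lean` module docstring; Literature cannot import Summits, so the identification is made here).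
[cite: MazurTateTeitelbaum1986, §I.10 and §I.13] [cite: GreenbergLNM1716, Conj. 1.11 (shape only)] -/
theorem muAnZeroAt_of_record_muClaim (hμ : r.MuClaim) (hmu : r.mu ≠ []) :
    X11a.MuAnZeroAt r.curve r.p :=
  fun f hf ϖ hϖ => hμ hmu f hf ϖ hϖ

/-- **The record's pair lies in `ClassX11a`** (the tree's predicate, not its unfolding): from a passing
recheck and the claim (`Record.classX11a_of_claim` of `Claim.lean`).
[cite: Skinner2016PacificMC, Thm. C (complement of hypothesis (ii) inside rank 0, p ≥ 3, mult, irr)] -/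
theorem classX11a_of_record_claim (hc : r.check = true) (h : r.Claim) : ClassX11a r.curve r.p :=
  r.classX11a_of_claim hc h

/-- **RECORD DOOR (crux-U currency): a certificate record with a μ-witness closes the Euler half at
its pair.** For a record `r` passing the kernel recheck, whose `Claim` holds (analytic rank `0`, `Mult`,
`Irr`, `¬Ram`, …), whose μ-witness column is non-empty with `MuClaim` holding, and whose mod-`p` image is
NOT onto (the image bit, displayed — images `3Ns/3Nn/5Ns/5S4/7Ns` are certified by two engines, not by
the kernel): `Typed.MissingUpperBoundAt r.curve r.p`, modulo the ten facts + Greenberg–Stevens at the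
pair. The per-pair shape for ty3's display files on the non-surjective leaf.
[cite: Kato2004Asterisque, Thm. 12.4 (p. 221), §17.13 (pp. 279–280)] [cite: Wuthrich2014, Cor. 18 (p. 398)]
[cite: SteinWuthrich2013, Thm. 6.1 (p. 20)] [cite: Miller2011LMS, Def. 1.1] -/
theorem missingUpperBoundAt_of_record_muClaim
    (hJs : thm61_splitMultiplicative) (hJn : thm61_nonsplitMultiplicative)
    (hGZK : rank_eq_analyticRank_of_analyticRank_le_one) (hpar : nonempty_modularParametrizationData)
    (h12 : Kato2004.thm12_4)
    (hns : Kato2004.exists_multDivisibilityInputs_nonsplit)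
    (hsp : Kato2004.exists_multDivisibilityInputs_split)
    (h15 : thm15_isTorsion_multiplicative_rat)
    (h18 : Wuthrich2014.corollary18_padicLFunction_mem_iwasawaAlgebra_multiplicative)
    (hfine : Kato2004.exists_multDivisibilityInputs_fine)
    (hGS : greenberg_stevens (W := r.curve) (p := r.p))
    (hc : r.check = true) (h : r.Claim) (hnsj : ¬ Surj r.curve r.p)
    (hmu : r.mu ≠ []) (hμ : r.MuClaim) : MissingUpperBoundAt r.curve r.p :=
  (classX11a_of_record_claim r hc h).missingUpperBoundAt_of_muAnZeroAt_of_not_surj hJs hJn hGZK hpar h12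
    hns hsp h15 h18 hfine hGS hnsj (muAnZeroAt_of_record_muClaim r hμ hmu)

/-- **RECORD DOOR (`BSD(E,p)`): a UNIT certificate record with a μ-witness closes its pair** —
`r.ordpShaAn = 0` (the derived `v_p(#Ш_an)`, so the lower half is free: `Record.padicValRat_shaAn_eq_zero`)
and the μ-claim door for the upper half. PER PAIR (E1 currency), modulo the ten facts + GS + the image
bit + the μ-claim; not a class theorem. [cite: Miller2011LMS, §1 and Def. 1.1]
[cite: Kato2004Asterisque, §17.13 (pp. 279–280)] [cite: Wuthrich2014, Cor. 18 (p. 398)] -/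
theorem bsdp_of_record_muClaim
    (hJs : thm61_splitMultiplicative) (hJn : thm61_nonsplitMultiplicative)
    (hGZK : rank_eq_analyticRank_of_analyticRank_le_one) (hpar : nonempty_modularParametrizationData)
    (h12 : Kato2004.thm12_4)
    (hns : Kato2004.exists_multDivisibilityInputs_nonsplit)
    (hsp : Kato2004.exists_multDivisibilityInputs_split)
    (h15 : thm15_isTorsion_multiplicative_rat)
    (h18 : Wuthrich2014.corollary18_padicLFunction_mem_iwasawaAlgebra_multiplicative)
    (hfine : Kato2004.exists_multDivisibilityInputs_fine)
    (hGS : greenberg_stevens (W := r.curve) (p := r.p))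
    (hc : r.check = true) (h : r.Claim) (hnsj : ¬ Surj r.curve r.p)
    (hmu : r.mu ≠ []) (hμ : r.MuClaim) (hord : r.ordpShaAn = 0) : BSDp r.curve r.p := by
  have hX : ClassX11a r.curve r.p := classX11a_of_record_claim r hc h
  obtain ⟨-, -, -, -, -, -, -, hsha, -, -⟩ := h
  exact hX.bsdp_of_muAnZeroAt_of_not_surj_of_unit hJs hJn hGZK hpar h12 hns hsp h15 h18 hfine hGS hnsj
    (muAnZeroAt_of_record_muClaim r hμ hmu) hsha (r.padicValRat_shaAn_eq_zero hc hord)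

/-- **RECORD DOOR, NON-SPLIT variant (crux-U currency) — no Greenberg–Stevens binder**: for a record
with `r.split = false` the claim gives `¬ split` at `p`, where `greenberg_stevens` is vacuous (part 6
§1c). Displayed: the ten facts, `r.check`, `r.Claim`, the image bit, the μ-claim.
[cite: Kato2004Asterisque, Thm. 12.4 (p. 221), §17.13 (pp. 279–280)] [cite: Wuthrich2014, Cor. 18 (p. 398)]
[cite: SteinWuthrich2013, Thm. 6.1 (p. 20)] [cite: Miller2011LMS, Def. 1.1] -/
theorem missingUpperBoundAt_of_record_muClaim_of_nonsplit
    (hJs : thm61_splitMultiplicative) (hJn : thm61_nonsplitMultiplicative)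
    (hGZK : rank_eq_analyticRank_of_analyticRank_le_one) (hpar : nonempty_modularParametrizationData)
    (h12 : Kato2004.thm12_4)
    (hns : Kato2004.exists_multDivisibilityInputs_nonsplit)
    (hsp : Kato2004.exists_multDivisibilityInputs_split)
    (h15 : thm15_isTorsion_multiplicative_rat)
    (h18 : Wuthrich2014.corollary18_padicLFunction_mem_iwasawaAlgebra_multiplicative)
    (hfine : Kato2004.exists_multDivisibilityInputs_fine)
    (hc : r.check = true) (h : r.Claim) (hsplit : r.split = false) (hnsj : ¬ Surj r.curve r.p)
    (hmu : r.mu ≠ []) (hμ : r.MuClaim) : MissingUpperBoundAt r.curve r.p := by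
  have hX : ClassX11a r.curve r.p := classX11a_of_record_claim r hc h
  obtain ⟨-, -, -, -, -, -, hnsp, -, -, -⟩ := h
  exact hX.missingUpperBoundAt_of_muAnZeroAt_of_not_surj_of_nonsplit hJs hJn hGZK hpar h12 hns hsp h15 h18
    hfine hnsj (hnsp hsplit) (muAnZeroAt_of_record_muClaim r hμ hmu)

/-- **RECORD DOOR, NON-SPLIT UNIT variant (`BSD(E,p)`) — no Greenberg–Stevens binder**:
`r.split = false`, `r.ordpShaAn = 0`, the claim, the image bit and the μ-claim give `BSDp r.curve r.p`
modulo the ten facts. PER PAIR (E1 currency). [cite: Miller2011LMS, §1 and Def. 1.1]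
[cite: Kato2004Asterisque, §17.13 (pp. 279–280)] [cite: Wuthrich2014, Cor. 18 (p. 398)] -/
theorem bsdp_of_record_muClaim_of_nonsplit
    (hJs : thm61_splitMultiplicative) (hJn : thm61_nonsplitMultiplicative)
    (hGZK : rank_eq_analyticRank_of_analyticRank_le_one) (hpar : nonempty_modularParametrizationData)
    (h12 : Kato2004.thm12_4)
    (hns : Kato2004.exists_multDivisibilityInputs_nonsplit)
    (hsp : Kato2004.exists_multDivisibilityInputs_split)
    (h15 : thm15_isTorsion_multiplicative_rat)
    (h18 : Wuthrich2014.corollary18_padicLFunction_mem_iwasawaAlgebra_multiplicative)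
    (hfine : Kato2004.exists_multDivisibilityInputs_fine)
    (hc : r.check = true) (h : r.Claim) (hsplit : r.split = false) (hnsj : ¬ Surj r.curve r.p)
    (hmu : r.mu ≠ []) (hμ : r.MuClaim) (hord : r.ordpShaAn = 0) : BSDp r.curve r.p := by
  have hX : ClassX11a r.curve r.p := classX11a_of_record_claim r hc h
  obtain ⟨-, -, -, -, -, -, hnsp, hsha, -, -⟩ := h
  exact hX.bsdp_of_muAnZeroAt_of_not_surj_of_nonsplit_of_unit hJs hJn hGZK hpar h12 hns hsp h15 h18 hfine
    hnsj (hnsp hsplit) (muAnZeroAt_of_record_muClaim r hμ hmu) hsha (r.padicValRat_shaAn_eq_zero hc hord)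

end Records

/-! ### §3 The Kraus–Oesterlé door: a finite congruence list gives the `θ` ∕ `hiso` binder -/

/-- **Kraus–Oesterlé 1992, Prop. 4 (ii) ⇒ (i) on X11a** (print-faithful Hasse–Weil twin
`KrausOesterle1992.prop4_torsionIso_of_congruences_hasseWeil`, named fact `hKO`): for a globally minimal
partner `A` and the congruence list below `μ(M)/6` — `a_ℓ(W) ≡ a_ℓ(A) (mod p)` at the primes
`ℓ ∤ N_W N_A`, `a_ℓ(W)·a_ℓ(A) ≡ ℓ + 1 (mod p)` (Hasse–Weil coefficients) at the primes with
`v_ℓ(N_W N_A) = 1` — there is a `Γ_ℚ`-equivariant `A[p] ≃+ W[p]`; `E[p]` irreducible comes from the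
class. This is the `θ`/`hθ` binder of part 1's visibility closing form `X11a.bsdp_of_congr_of_rank_two`
and the `hiso` binder of part 3's μ-transport forms, from a FINITE displayed certificate instead of a
displayed isomorphism. [cite: KrausOesterle1992, Prop. 4 (ii) ⇒ (i), pp. 263–264; p. 265 L13–15] -/
theorem _root_.Summit.BirchSwinnertonDyer.Rank1Residual.ClassX11a.torsionIso_of_krausOesterle
    (hKO : prop4_torsionIso_of_congruences_hasseWeil) (hX : ClassX11a W p)
    (A : WeierstrassCurve ℚ) [A.IsElliptic] [A.IsGloballyMinimal]
    (hcong : ∀ (ℓ : ℕ) [Fact ℓ.Prime], 6 * ℓ < gammaZeroIndex (modulus W A) →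
      (padicValNat ℓ (W.conductorNorm ℤ * A.conductorNorm ℤ) = 0 →
          (p : ℤ) ∣ W.frobeniusTrace ℓ - A.frobeniusTrace ℓ) ∧
        (padicValNat ℓ (W.conductorNorm ℤ * A.conductorNorm ℤ) = 1 →
          (p : ℤ) ∣ W.LFunction ℓ * A.LFunction ℓ - (ℓ + 1))) :
    ∃ e : geomTorsion A (p : ℤ) ≃+ geomTorsion W (p : ℤ),
      ∀ (σ : Field.absoluteGaloisGroup ℚ) (P : geomTorsion A (p : ℤ)), e (σ • P) = σ • e P :=
  torsionIso_of_congruences_hasseWeil hKO W A p hX.irr hcong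

open IsDedekindDomain NumberField in
/-- **Visibility ⇒ `BSD(E,p)` on X11a with the congruence read from a Kraus–Oesterlé list** (part 1
§6 `X11a.bsdp_of_congr_of_rank_two` with `θ`/`hθ` supplied by `ClassX11a.torsionIso_of_krausOesterle`):
remaining per pair are the image bit, `ord_p #Ш_an ≤ 2`, the rank-two partner `W'` (globally minimal)
with its finite congruence list, the set `S` and the local triviality of `W'(ℚ_v)[p]` on `S`.
[cite: KrausOesterle1992, Prop. 4 (ii) ⇒ (i), pp. 263–264] [cite: CremonaMazur2000, §3 (p. 21)]
[cite: Wuthrich2014, Prop. 21 (p. 400)] -/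
theorem bsdp_of_krausOesterle_of_rank_two (hKO : prop4_torsionIso_of_congruences_hasseWeil)
    (hCT : exists_casselsTate_pairing (K := ℚ))
    (hW : sha_dvd_analyticSha) (hGZK : rank_eq_analyticRank_of_analyticRank_le_one)
    (hmod : hasEntireLFunction_rat) (hX : ClassX11a W p) (hsurj : Surj W p)
    {q : ℚ} (hq : shaAn W = (q : ℂ)) (hv : padicValRat p q ≤ 2)
    (W' : WeierstrassCurve ℚ) [W'.IsElliptic] [W'.IsGloballyMinimal]
    (hcong : ∀ (ℓ : ℕ) [Fact ℓ.Prime], 6 * ℓ < gammaZeroIndex (modulus W W') →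
      (padicValNat ℓ (W.conductorNorm ℤ * W'.conductorNorm ℤ) = 0 →
          (p : ℤ) ∣ W.frobeniusTrace ℓ - W'.frobeniusTrace ℓ) ∧
        (padicValNat ℓ (W.conductorNorm ℤ * W'.conductorNorm ℤ) = 1 →
          (p : ℤ) ∣ W.LFunction ℓ * W'.LFunction ℓ - (ℓ + 1)))
    (hrank : 2 ≤ W'.mordellWeilRank) (S : Finset (HeightOneSpectrum (𝓞 ℚ)))
    (hS : ∀ v : HeightOneSpectrum (𝓞 ℚ), v ∉ S →
      W.HasGoodReductionAt v ∧ W'.HasGoodReductionAt v ∧ (p : 𝓞 ℚ) ∉ v.asIdeal)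
    (hloc : ∀ v ∈ S, Nat.card (nsmulAddMonoidHom p :
      (W'.baseChange (v.adicCompletion ℚ)).toAffine.Point →+ _).ker = 1) :
    BSDp W p := by
  obtain ⟨θ, hθ⟩ := hX.torsionIso_of_krausOesterle hKO W' hcong
  exact bsdp_of_congr_of_rank_two hCT hW hGZK hmod hX hsurj hq hv W' θ hθ hrank S hS hloc

end Summit.BirchSwinnertonDyer.Rank1Residual.X11a

end
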